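import Mathlib
import Summits.NavierStokesRegularity.NavierStokesRegularity.Theorems.WakeRatchetTailRatchetMultiplicativeNoGo
import HarnessLib

/-!
# `WakeRatchet.TailRatchet` (stmt-NavierStokesRegularity-21808), door D1 / inner problem H-in:
# leading-edge tails of the uniform-lattice dyadic front and the linear comparison principle

The construction that would close stmt-21808 as REFUTED through the dyadic door (`DyadicScalarFronts`,
p589335) has a parameter-free INNER PROBLEM (H-in): a travelling front of the uniform dyadic lattice
`u̇_n = u_{n-1}² − u_n u_{n+1}`, i.e. (delay scaled to `1`) a profile `ψ ≥ 0` with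
`ψ' = ψ(·+1)² − ψ·ψ(·−1)`, `ψ(−∞) = 0`, `ψ(+∞) = ½`.  A mixed-monotone Schauder scheme (evidence
`DOORS-21808-leafhand-g1.md` on the item; Schauder is the tree's
`Literature.Analysis.Convex.SchauderFixedPoint`) reduces H-in to an ordered pair `ψ_lo ≤ ψ_hi` with
  (i)  `ψ_hi' ≥ ψ_hi(·+1)² − ψ_hi·ψ_lo(·−1)`,   (ii)  `ψ_lo' ≤ ψ_lo(·+1)² − ψ_lo·ψ_hi(·−1)`.
This file proves the two facts about that scheme which no finite computation can supply:

* the LEADING EDGE IS DOUBLY EXPONENTIAL: for `ψ_lo = exp(−A e^{−aξ})` the sufficient form of (ii),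
  `ψ_lo' + ψ_lo ≤ ψ_lo(·+1)²` (valid against any partner `ψ_hi ≤ 1`), holds on a left half-line as
  soon as `a > log 2` (`subTail_eventually`); for `ψ_hi = exp(−B e^{−bξ})` the sufficient form of
  (i), `ψ_hi' ≥ ψ_hi(·+1)²`, holds on a left half-line as soon as `b ≤ log 2` (`superTail_eventually`);
  and `a > b` orders the pair there (`tail_le_tail_eventually`).  (An exponential edge `c e^{λξ}` can
  never satisfy (ii): its source `ψ(ξ+1)² ≍ e^{2λξ}` is negligible against `ψ' ≍ e^{λξ}`.)
* the LINEAR COMPARISON PRINCIPLE behind «`S` maps the order interval into itself»: if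
  `d' ≥ −d·φ` with `φ ≥ 0` continuous and integrable and `d → 0` at `−∞`, then `d ≥ 0`
  (`nonneg_of_deriv_ge_neg_mul`).

HONEST FRAMING: elementary real analysis for a MODEL lattice problem; nothing here concerns the
Navier–Stokes equations; stmt-21808 is neither proved nor refuted here, and H-in itself stays open
(the transition region between the tails is the part a certificate must cover).
-/

noncomputable section

set_option linter.dupNamespace false

namespace Summit.NavierStokesRegularity.NavierStokesRegularity.Theorems

namespace WakeRatchetInnerFront

open MeasureTheory Set Filter Topology intervalIntegral
open WakeRatchetMultiplicativeNoGo

/-! ## The doubly-exponential tail `ξ ↦ exp(−A e^{−aξ})` -/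

/-- Derivative of the doubly-exponential tail: `(exp(−A e^{−aξ}))' = A a e^{−aξ} · exp(−A e^{−aξ})`.
[folklore] -/
theorem hasDerivAt_tail (A a ξ : ℝ) :
    HasDerivAt (fun x => Real.exp (-A * Real.exp (-a * x)))
      (A * a * Real.exp (-a * ξ) * Real.exp (-A * Real.exp (-a * ξ))) ξ := by
  have h1 : HasDerivAt (fun x => -a * x) (-a) ξ := by
    simpa using (hasDerivAt_id ξ).const_mul (-a)
  have h2 : HasDerivAt (fun x => Real.exp (-a * x)) (Real.exp (-a * ξ) * (-a)) ξ := h1.exp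
  have h3 : HasDerivAt (fun x => -A * Real.exp (-a * x)) (-A * (Real.exp (-a * ξ) * (-a))) ξ :=
    h2.const_mul (-A)
  refine (h3.exp).congr_deriv ?_
  ring

/-- **Sub-solution tail.**  For `a > log 2` (and `A > 0`) the doubly-exponential tail
`ψ(ξ) = exp(−A e^{−aξ})` satisfies `ψ'(ξ) + ψ(ξ) ≤ ψ(ξ+1)²` for all `ξ ≤ −(2Aa/c²)/a`,
`c = A(1 − 2e^{−a})` — the sufficient form of the sub-solution inequality (ii) against any partner
`ψ_hi ≤ 1`.  (With `u = e^{−aξ}`: `(Aau + 1)e^{−Au} ≤ e^{−2Ae^{−a}u}` iff `Aau + 1 ≤ e^{cu}`.)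
[folklore] -/
theorem subTail_eventually {A a : ℝ} (hA : 0 < A) (ha : Real.log 2 < a) :
    ∃ ξ₀ : ℝ, ∀ ξ, ξ ≤ ξ₀ →
      A * a * Real.exp (-a * ξ) * Real.exp (-A * Real.exp (-a * ξ)) + Real.exp (-A * Real.exp (-a * ξ))
        ≤ Real.exp (-A * Real.exp (-a * (ξ + 1))) ^ 2 := by
  have ha0 : 0 < a := lt_trans (Real.log_pos (by norm_num)) ha
  have h2a : 2 * Real.exp (-a) < 1 := by
    have h := Real.exp_lt_exp.2 (neg_lt_neg ha)
    rw [Real.exp_neg (Real.log 2), Real.exp_log (by norm_num : (0 : ℝ) < 2)] at h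
    linarith
  set c : ℝ := A * (1 - 2 * Real.exp (-a)) with hc
  have hc0 : 0 < c := mul_pos hA (by linarith)
  set K : ℝ := 2 * A * a / c ^ 2 with hK
  have hK0 : 0 ≤ K := by positivity
  refine ⟨-K / a, fun ξ hξ => ?_⟩
  set u : ℝ := Real.exp (-a * ξ) with hu
  have hu0 : 0 < u := Real.exp_pos _
  -- `u ≥ K`
  have hKu : K ≤ u := by
    have h1 : K ≤ -a * ξ := by
      have : ξ * a ≤ -K := by
        have := mul_le_mul_of_nonneg_right hξ ha0.le
        rwa [div_mul_cancel₀ _ ha0.ne'] at this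
      linarith
    have h2 := Real.add_one_le_exp (-a * ξ)
    linarith
  -- `A a u + 1 ≤ e^{c u}`
  have hkey : A * a * u + 1 ≤ Real.exp (c * u) := by
    have hq := Real.quadratic_le_exp_of_nonneg (mul_nonneg hc0.le hu0.le : 0 ≤ c * u)
    have h1 : 2 * A * a ≤ c ^ 2 * u := by
      have := mul_le_mul_of_nonneg_left hKu (sq_nonneg c)
      rwa [hK, mul_div_cancel₀ _ (pow_ne_zero 2 hc0.ne')] at this
    have h2 : A * a * u ≤ (c * u) ^ 2 / 2 := by nlinarith
    nlinarith [mul_nonneg hc0.le hu0.le]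
  have hsplit : Real.exp (-a * (ξ + 1)) = Real.exp (-a) * u := by
    rw [show -a * (ξ + 1) = -a + -a * ξ by ring, Real.exp_add]
  calc A * a * u * Real.exp (-A * u) + Real.exp (-A * u)
        = (A * a * u + 1) * Real.exp (-A * u) := by ring
    _ ≤ Real.exp (c * u) * Real.exp (-A * u) :=
        mul_le_mul_of_nonneg_right hkey (Real.exp_pos _).le
    _ = Real.exp (-A * Real.exp (-a * (ξ + 1))) ^ 2 := by
        rw [← Real.exp_add, sq, ← Real.exp_add, hsplit, hc]
        congr 1
        ring

/-- **Super-solution tail.**  For `0 < b ≤ log 2` (and `B > 0`) the doubly-exponential tail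
`ψ(ξ) = exp(−B e^{−bξ})` satisfies `ψ'(ξ) ≥ ψ(ξ+1)²` for all `ξ ≤ −1/(B b²)` — the sufficient form of
the super-solution inequality (i).  (With `u = e^{−bξ}`: `Bbu e^{−Bu} ≥ e^{−2Be^{−b}u}` as soon as
`Bbu ≥ 1`, because `2e^{−b} ≥ 1`.) [folklore] -/
theorem superTail_eventually {B b : ℝ} (hB : 0 < B) (hb : 0 < b) (hb2 : b ≤ Real.log 2) :
    ∃ ξ₀ : ℝ, ∀ ξ, ξ ≤ ξ₀ →
      Real.exp (-B * Real.exp (-b * (ξ + 1))) ^ 2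
        ≤ B * b * Real.exp (-b * ξ) * Real.exp (-B * Real.exp (-b * ξ)) := by
  have h2b : 1 ≤ 2 * Real.exp (-b) := by
    have h := Real.exp_le_exp.2 (neg_le_neg hb2)
    rw [Real.exp_neg (Real.log 2), Real.exp_log (by norm_num : (0 : ℝ) < 2)] at h
    linarith
  refine ⟨-1 / (B * b ^ 2), fun ξ hξ => ?_⟩
  set u : ℝ := Real.exp (-b * ξ) with hu
  have hu0 : 0 < u := Real.exp_pos _
  have hBb : 0 < B * b := mul_pos hB hb
  -- `B b u ≥ 1`
  have hkey : 1 ≤ B * b * u := by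
    have h1 : 1 / (B * b) ≤ -b * ξ := by
      have := mul_le_mul_of_nonneg_right hξ hb.le
      have e : -1 / (B * b ^ 2) * b = -(1 / (B * b)) := by
        field_simp
      rw [e] at this
      linarith
    have h2 := Real.add_one_le_exp (-b * ξ)
    have h3 : 1 / (B * b) * (B * b) = 1 := div_mul_cancel₀ _ hBb.ne'
    nlinarith
  have hsplit : Real.exp (-b * (ξ + 1)) = Real.exp (-b) * u := by
    rw [show -b * (ξ + 1) = -b + -b * ξ by ring, Real.exp_add]
  have hexp_le : Real.exp (-(B * (2 * Real.exp (-b) - 1)) * u) ≤ 1 := by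
    rw [Real.exp_le_one_iff]
    have : 0 ≤ B * (2 * Real.exp (-b) - 1) := mul_nonneg hB.le (by linarith)
    nlinarith
  calc Real.exp (-B * Real.exp (-b * (ξ + 1))) ^ 2
        = Real.exp (-(B * (2 * Real.exp (-b) - 1)) * u) * Real.exp (-B * u) := by
          rw [sq, ← Real.exp_add, ← Real.exp_add, hsplit]
          congr 1
          ring
    _ ≤ (B * b * u) * Real.exp (-B * u) :=
          mul_le_mul_of_nonneg_right (hexp_le.trans hkey) (Real.exp_pos _).le
    _ = B * b * u * Real.exp (-B * u) := by ring

/-- **Ordering of the tails.**  If `a > b` then `exp(−A e^{−aξ}) ≤ exp(−B e^{−bξ})` for all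
`ξ ≤ −B/(A(a−b))` (`A > 0`): the sub-solution edge lies below the super-solution edge.
[folklore] -/
theorem tail_le_tail_eventually {A a B b : ℝ} (hA : 0 < A) (hab : b < a) :
    ∃ ξ₀ : ℝ, ∀ ξ, ξ ≤ ξ₀ →
      Real.exp (-A * Real.exp (-a * ξ)) ≤ Real.exp (-B * Real.exp (-b * ξ)) := by
  refine ⟨-B / (A * (a - b)), fun ξ hξ => ?_⟩
  have hab0 : 0 < a - b := sub_pos.2 hab
  rw [Real.exp_le_exp]
  -- `B e^{-bξ} ≤ A e^{-aξ}` because `e^{-(a-b)ξ} ≥ -(a-b)ξ ≥ B/A`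
  have h1 : B / A ≤ -(a - b) * ξ := by
    have := mul_le_mul_of_nonneg_right hξ hab0.le
    have e : -B / (A * (a - b)) * (a - b) = -(B / A) := by
      field_simp
    rw [e] at this
    linarith
  have h2 : B / A ≤ Real.exp (-(a - b) * ξ) := by
    have := Real.add_one_le_exp (-(a - b) * ξ); linarith
  have h3 : B ≤ A * Real.exp (-(a - b) * ξ) := by
    have := mul_le_mul_of_nonneg_left h2 hA.le
    rwa [mul_div_cancel₀ _ hA.ne'] at this
  have h4 : Real.exp (-a * ξ) = Real.exp (-(a - b) * ξ) * Real.exp (-b * ξ) := by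
    rw [← Real.exp_add]; ring_nf
  rw [h4]
  have h5 := Real.exp_pos (-b * ξ)
  nlinarith [mul_le_mul_of_nonneg_right h3 h5.le]

/-! ## The linear comparison principle -/

/-- **Linear comparison from the leading edge.**  If `d' ≥ −d·φ` on `ℝ` with `φ ≥ 0` continuous and
`d(ξ) → 0` as `ξ → −∞`, then `d ≥ 0` everywhere (`d·exp(∫₀ φ)` is non-decreasing and tends to `0⁺`
in the sense `≥ −|d| → 0` at `−∞`).  This is the step «the solution operator of
`w' = χ(·+1)² − w φ(·−1)` is order-preserving in the source and order-reversing in the damping» of the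
mixed-monotone scheme. [folklore] -/
theorem nonneg_of_deriv_ge_neg_mul {d d' φ : ℝ → ℝ} (hφc : Continuous φ) (hφ0 : ∀ x, 0 ≤ φ x)
    (hd : ∀ x, HasDerivAt d (d' x) x) (hineq : ∀ x, -(d x * φ x) ≤ d' x)
    (hlim : Tendsto d atBot (𝓝 0)) : ∀ x, 0 ≤ d x := by
  set G : ℝ → ℝ := fun x => ∫ t in (0 : ℝ)..x, φ t with hGdef
  have hG : ∀ y, HasDerivAt G (φ y) y := fun y => (hφc.integral_hasStrictDerivAt 0 y).hasDerivAt
  set g : ℝ → ℝ := fun x => d x * Real.exp (G x) with hgdef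
  have hg : ∀ y, HasDerivAt g ((d' y + d y * φ y) * Real.exp (G y)) y := by
    intro y
    refine ((hd y).mul (hG y).exp).congr_deriv ?_
    ring
  have hmono : Monotone g := by
    refine monotone_of_deriv_nonneg (fun y => (hg y).differentiableAt) fun y => ?_
    rw [(hg y).deriv]
    exact mul_nonneg (by linarith [hineq y]) (Real.exp_pos _).le
  -- `G η ≤ 0` for `η ≤ 0`, hence `g η ≥ -|d η|`
  have hGle : ∀ η, η ≤ 0 → G η ≤ 0 := by
    intro η hη
    have h1 : 0 ≤ ∫ t in η..(0 : ℝ), φ t := intervalIntegral.integral_nonneg hη fun t _ => hφ0 t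
    have h2 : G η = -∫ t in η..(0 : ℝ), φ t := by rw [hGdef]; exact integral_symm _ _
    linarith
  have hglow : ∀ η, η ≤ 0 → -|d η| ≤ g η := by
    intro η hη
    have he1 : Real.exp (G η) ≤ 1 := Real.exp_le_one_iff.2 (hGle η hη)
    have he0 : 0 < Real.exp (G η) := Real.exp_pos _
    show -|d η| ≤ d η * Real.exp (G η)
    rcases le_or_gt 0 (d η) with h | h
    · rw [abs_of_nonneg h]; nlinarith
    · rw [abs_of_neg h]; nlinarith
  intro x
  -- if `g x < 0`, pick `η ≤ min x 0` with `|d η| < -g x`: contradiction with monotonicity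
  have hgx : 0 ≤ g x := by
    by_contra hneg
    have hneg : g x < 0 := lt_of_not_ge hneg
    have hev : ∀ᶠ η in atBot, dist (d η) 0 < -g x := Metric.tendsto_nhds.1 hlim _ (by linarith)
    obtain ⟨η, hη1, hη2⟩ := (hev.and (eventually_le_atBot (min x 0))).exists
    rw [Real.dist_eq, sub_zero] at hη1
    have h1 := hglow η (hη2.trans (min_le_right _ _))
    have h2 := hmono (hη2.trans (min_le_left _ _))
    linarith
  have he0 : 0 < Real.exp (G x) := Real.exp_pos _
  by_contra hdx
  have hdx : d x < 0 := lt_of_not_ge hdx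
  have : g x < 0 := by show d x * Real.exp (G x) < 0; nlinarith
  linarith

/-! ## Obstruction at the TRAILING edge (appended 2026-08-31, same seat): the coupled sub/super
scheme of the header is VOID

CORRECTION OF THE HEADER'S PLAN.  The mixed-monotone scheme (i)–(ii) needs an ordered pair with a
common limit `L = ½` at `+∞` (integrating (i) forces `L_hi(L_hi − L_lo) ≤ 0`).  Writing
`ψ_hi = ½ + η` with `η ≥ 0`, inequality (i) gives, after dropping non-negative terms,
`η' + ½η ≥ η(·+1)` on a right half-line — and `plateau_supersolution_trivial` below shows that a
bounded non-negative `η` with this property vanishes identically there; then (i) forces `ψ_lo ≥ ½` and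
the flat plateau propagates leftwards through the profile equation to `ψ ≡ ½`, contradicting
`ψ(−∞) = 0`.  So NO admissible coupled pair exists: order-interval / comparison constructions cannot
produce the inner front.  The reason is structural: the linearisation of the profile equation at the
plateau, `η' = η(·+1) − ½η − ½η(·−1)`, has characteristic function
`G(κ) = e^{−κ} + κ − ½ − ½e^{κ}` for modes `e^{−κξ}`, and `G(κ) < 0` for every `κ > 0`
(`plateau_characteristic_neg`): there is NO real decaying mode, the approach to the plateau is
OSCILLATORY, the front is not monotone at its trailing edge.  What survives: the leading-edge lemmas
above (any construction must reproduce the doubly-exponential edge), and the conclusion for the census —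
H-in needs a whole-line shooting / degree / Newton–Kantorovich argument, not a monotone scheme. -/

/-- **No real decaying mode at the plateau.**  For every `κ > 0`,
`e^{−κ} + κ − ½ − ½ e^{κ} < 0`: the linearised trailing-edge equation `η' = η(·+1) − ½η − ½η(·−1)`
of the inner dyadic front has no solution `e^{−κξ}` with real `κ > 0` (from
`e^{κ} ≥ 1 + κ + κ²/2 + κ³/6` and `e^{−κ} ≤ 1 − κ + κ²/2`). [folklore] -/
theorem plateau_characteristic_neg {κ : ℝ} (hκ : 0 < κ) :
    Real.exp (-κ) + κ - 1 / 2 - Real.exp κ / 2 < 0 := by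
  -- `e^{κ} ≥ 1 + κ + κ²/2 + κ³/6`
  have h4 := Real.sum_le_exp_of_nonneg hκ.le 4
  simp only [Finset.sum_range_succ, Finset.sum_range_zero, Nat.factorial, Nat.succ_eq_add_one,
    pow_zero, pow_one, Nat.cast_one, zero_add, mul_one] at h4
  norm_num at h4
  -- `e^{-κ} ≤ 1 − κ + κ²/2` from `1 + κ + κ²/2 ≤ e^{κ}` and `e^{-κ} e^{κ} = 1`
  have hq := Real.quadratic_le_exp_of_nonneg hκ.le
  have hmul : Real.exp (-κ) * Real.exp κ = 1 := by
    rw [← Real.exp_add, neg_add_cancel, Real.exp_zero]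
  have hpos := Real.exp_pos (-κ)
  have hneg : Real.exp (-κ) ≤ 1 - κ + κ ^ 2 / 2 := by
    nlinarith [mul_le_mul_of_nonneg_left hq hpos.le, sq_nonneg κ, sq_nonneg (κ ^ 2),
      (by positivity : (0 : ℝ) < 1 + κ + κ ^ 2 / 2)]
  nlinarith [sq_nonneg (κ - 3 / 2), hκ]

/-- **A bounded non-negative plateau super-solution is trivial.**  If `η ≥ 0` is bounded on `[ξ₁, ∞)`,
differentiable, and `η' + ½η ≥ η(·+1)` on `[ξ₁, ∞)`, then `η ≡ 0` on `[ξ₁, ∞)`.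
(`ζ = e^{ξ/2}η` is non-decreasing, hence `ζ' ≥ e^{−1/2}ζ(·+1) ≥ e^{−1/2}ζ`, so `ζ` grows at least like
`e^{kξ}`, `k = e^{−1/2} > ½`, and `η = e^{−ξ/2}ζ` would be unbounded unless `ζ ≡ 0`.)  Consequence:
inequality (i) of the header's scheme admits no `ψ_hi = ½ + η → ½` other than the flat plateau.
[folklore] -/
theorem plateau_supersolution_trivial {η η' : ℝ → ℝ} {ξ₁ M : ℝ}
    (hd : ∀ x, HasDerivAt η (η' x) x) (h0 : ∀ x, ξ₁ ≤ x → 0 ≤ η x)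
    (hM : ∀ x, ξ₁ ≤ x → η x ≤ M) (hineq : ∀ x, ξ₁ ≤ x → η (x + 1) ≤ η' x + 1 / 2 * η x) :
    ∀ x, ξ₁ ≤ x → η x = 0 := by
  -- `ζ = e^{x/2} η` and its derivative
  set ζ : ℝ → ℝ := fun x => Real.exp (x / 2) * η x with hζdef
  have hζ : ∀ x, HasDerivAt ζ (Real.exp (x / 2) * (η' x + 1 / 2 * η x)) x := by
    intro x
    have h1 : HasDerivAt (fun y => Real.exp (y / 2)) (Real.exp (x / 2) * (1 / 2)) x :=
      ((hasDerivAt_id x).div_const 2).exp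
    refine (h1.mul (hd x)).congr_deriv ?_
    ring
  have hζ0 : ∀ x, ξ₁ ≤ x → 0 ≤ ζ x := fun x hx => mul_nonneg (Real.exp_pos _).le (h0 x hx)
  -- `ζ` is non-decreasing on `[ξ₁, ∞)`
  have hmono : MonotoneOn ζ (Ici ξ₁) := by
    refine monotoneOn_of_hasDerivWithinAt_nonneg (convex_Ici ξ₁)
      (fun x _ => (hζ x).continuousAt.continuousWithinAt)
      (fun x _ => (hζ x).hasDerivWithinAt) fun x hx => ?_
    rw [interior_Ici] at hx
    have hx' : ξ₁ ≤ x := le_of_lt hx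
    have h1 : Real.exp (x / 2) * η (x + 1) ≤ Real.exp (x / 2) * (η' x + 1 / 2 * η x) :=
      mul_le_mul_of_nonneg_left (hineq x hx') (Real.exp_pos _).le
    exact le_trans (mul_nonneg (Real.exp_pos _).le (h0 (x + 1) (by linarith))) h1
  -- `ζ' ≥ k ζ` with `k = e^{-1/2}`
  set k : ℝ := Real.exp (-(1 / 2)) with hk
  have hk0 : 0 < k := Real.exp_pos _
  have hgrow : ∀ x, ξ₁ < x → k * ζ x ≤ Real.exp (x / 2) * (η' x + 1 / 2 * η x) := by
    intro x hx
    have hx' : ξ₁ ≤ x := le_of_lt hx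
    have h1 : Real.exp (x / 2) * η (x + 1) ≤ Real.exp (x / 2) * (η' x + 1 / 2 * η x) :=
      mul_le_mul_of_nonneg_left (hineq x hx') (Real.exp_pos _).le
    have h2 : Real.exp (x / 2) * η (x + 1) = k * ζ (x + 1) := by
      simp only [hζdef, hk]
      rw [← mul_assoc, ← Real.exp_add]
      congr 1; ring_nf
    have h3 : ζ x ≤ ζ (x + 1) := hmono (mem_Ici.2 hx') (mem_Ici.2 (by linarith)) (by linarith)
    nlinarith [mul_le_mul_of_nonneg_left h3 hk0.le]
  -- `ρ = ζ e^{-k x}` is non-decreasing on `[ξ₁, ∞)`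
  set ρ : ℝ → ℝ := fun x => ζ x * Real.exp (-k * x) with hρdef
  have hρ : ∀ x, HasDerivAt ρ
      ((Real.exp (x / 2) * (η' x + 1 / 2 * η x) - k * ζ x) * Real.exp (-k * x)) x := by
    intro x
    have h1 : HasDerivAt (fun y => Real.exp (-k * y)) (Real.exp (-k * x) * (-k)) x := by
      have := ((hasDerivAt_id x).const_mul (-k)).exp
      simpa using this
    refine ((hζ x).mul h1).congr_deriv ?_
    ring
  have hρmono : MonotoneOn ρ (Ici ξ₁) := by
    refine monotoneOn_of_hasDerivWithinAt_nonneg (convex_Ici ξ₁)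
      (fun x _ => (hρ x).continuousAt.continuousWithinAt)
      (fun x _ => (hρ x).hasDerivWithinAt) fun x hx => ?_
    rw [interior_Ici] at hx
    exact mul_nonneg (by linarith [hgrow x hx]) (Real.exp_pos _).le
  -- `k > 1/2` since `e < 4`
  have hk2 : 1 / 2 < k := by
    have he : Real.exp (1 / 2) < 2 := by
      by_contra h
      have h' : 2 ≤ Real.exp (1 / 2) := not_lt.1 h
      have h3 := Real.exp_one_lt_d9
      have hsq : Real.exp (1 / 2) * Real.exp (1 / 2) = Real.exp 1 := by
        rw [← Real.exp_add]; norm_num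
      nlinarith
    have hkk : k * Real.exp (1 / 2) = 1 := by
      rw [hk, ← Real.exp_add]; norm_num
    nlinarith [Real.exp_pos (1 / 2)]
  -- conclusion: `ζ x₀ = 0` for every `x₀ ≥ ξ₁`
  intro x₀ hx₀
  have hζx₀ : ζ x₀ = 0 := by
    by_contra hne
    have hpos : 0 < ζ x₀ := lt_of_le_of_ne (hζ0 x₀ hx₀) (Ne.symm hne)
    have hM0 : 0 ≤ M := (h0 x₀ hx₀).trans (hM x₀ hx₀)
    -- pick `x ≥ x₀` with `(k - 1/2) x` huge
    set L : ℝ := (M * Real.exp (k * x₀) / ζ x₀ + 1) / (k - 1 / 2) with hL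
    set x : ℝ := max x₀ (max L 0) with hxdef
    have hxx₀ : x₀ ≤ x := le_max_left _ _
    have hxL : L ≤ x := (le_max_left _ _).trans (le_max_right _ _)
    have hx0 : 0 ≤ x := (le_max_right _ _).trans (le_max_right _ _)
    -- `ρ x ≥ ρ x₀`, i.e. `ζ x ≥ ζ x₀ e^{k (x - x₀)}`
    have hρle : ρ x₀ ≤ ρ x := hρmono (mem_Ici.2 hx₀) (mem_Ici.2 (hx₀.trans hxx₀)) hxx₀
    have hηx : η x = Real.exp (-(x / 2)) * ζ x := by
      simp only [hζdef]
      rw [← mul_assoc, ← Real.exp_add]; norm_num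
    have hbound := hM x (hx₀.trans hxx₀)
    -- `e^{(k-1/2) x} ≥ 1 + (k - 1/2) x ≥ M e^{k x₀}/ζ x₀ + 1`
    have hlin : M * Real.exp (k * x₀) / ζ x₀ + 1 ≤ (k - 1 / 2) * x := by
      have := mul_le_mul_of_nonneg_left hxL (by linarith : (0 : ℝ) ≤ k - 1 / 2)
      rwa [hL, mul_div_cancel₀ _ (by linarith : (k - 1 / 2 : ℝ) ≠ 0)] at this
    have hexp := Real.add_one_le_exp ((k - 1 / 2) * x)
    -- assemble: `η x = e^{-x/2} ζ x ≥ e^{-x/2} ζ x₀ e^{-k x₀} e^{k x} = (ζ x₀ e^{-k x₀}) e^{(k - 1/2) x}`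
    have hζx : ζ x₀ * Real.exp (-k * x₀) * Real.exp (k * x) ≤ ζ x := by
      have e1 : ρ x * Real.exp (k * x) = ζ x := by
        simp only [hρdef]; rw [mul_assoc, ← Real.exp_add]; simp
      rw [← e1]
      exact mul_le_mul_of_nonneg_right hρle (Real.exp_pos _).le
    have hfinal : ζ x₀ * Real.exp (-k * x₀) * Real.exp ((k - 1 / 2) * x) ≤ η x := by
      rw [hηx]
      have e2 : Real.exp (-(x / 2)) * (ζ x₀ * Real.exp (-k * x₀) * Real.exp (k * x))
          = ζ x₀ * Real.exp (-k * x₀) * Real.exp ((k - 1 / 2) * x) := by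
        rw [show (k - 1 / 2) * x = -(x / 2) + k * x by ring, Real.exp_add]; ring
      rw [← e2]
      exact mul_le_mul_of_nonneg_left hζx (Real.exp_pos _).le
    have hc : 0 < ζ x₀ * Real.exp (-k * x₀) := mul_pos hpos (Real.exp_pos _)
    have hprod : Real.exp (-k * x₀) * Real.exp (k * x₀) = 1 := by
      rw [← Real.exp_add]; simp
    -- `η x ≥ c (1 + (k-1/2)x) ≥ c (M e^{k x₀}/ζ x₀ + 2) > M`
    have h1 : ζ x₀ * Real.exp (-k * x₀) * (M * Real.exp (k * x₀) / ζ x₀ + 2) ≤ η x := by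
      refine le_trans (mul_le_mul_of_nonneg_left (by linarith) hc.le) hfinal
    have h2 : ζ x₀ * Real.exp (-k * x₀) * (M * Real.exp (k * x₀) / ζ x₀ + 2)
        = M + 2 * (ζ x₀ * Real.exp (-k * x₀)) := by
      have hz : ζ x₀ ≠ 0 := hne
      calc ζ x₀ * Real.exp (-k * x₀) * (M * Real.exp (k * x₀) / ζ x₀ + 2)
          = M * (Real.exp (-k * x₀) * Real.exp (k * x₀)) * (ζ x₀ / ζ x₀)
              + 2 * (ζ x₀ * Real.exp (-k * x₀)) := by ring
        _ = M + 2 * (ζ x₀ * Real.exp (-k * x₀)) := by rw [hprod, div_self hz]; ring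
    linarith
  have : η x₀ = Real.exp (-(x₀ / 2)) * ζ x₀ := by
    simp only [hζdef]; rw [← mul_assoc, ← Real.exp_add]; norm_num
  rw [this, hζx₀, mul_zero]

end WakeRatchetInnerFront

end Summit.NavierStokesRegularity.NavierStokesRegularity.Theorems

end
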